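import Summits.QuantumFields.YangMills.Theorems.SoloBlindOddTorusRP
import Summits.QuantumFields.YangMills.Theorems.SoloBlindTwoPointSequence
import HarnessLib

/-!
# Log-convexity and monotonicity of time autocorrelations on odd tori
# (solo-QuantumFields-blind, rung D8, part 3)

Part 1 (`SoloBlindOddTorusRP`) showed that on an odd torus `(ℤ/L)^d`, `L = 2m+1 ≥ 3`, the time
autocorrelation `T_F(s) = ⟨F · F(· + s e₀)⟩_{Λ,β}` of a time-zero spatial observable `F` dominates
`⟨F⟩²` at EVERY separation `s` (one Osterwalder–Seiler reflection `θt = 1 - t` reaches all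
separations because `2` is a unit mod `L`).  Here the same reflection gives the full transfer-matrix
structure of `s ↦ T_F(s)` WITHOUT a transfer matrix:

* `timeTwoPt_schwarz` — the Gram inequality `T(t + t' - 1)² ≤ T(2t - 1) T(2t' - 1)` for slices
  `1 ≤ t, t' ≤ m + 1` of the closed positive half (Schwarz inequality of the OS form on the pair of
  translates `F_t, F_{t'}`; `ΘF_t = F_{1-t}`);
* `timeTwoPtSeq_logConvex` — CONSECUTIVE log-convexity `T(n+1)² ≤ T(n) T(n+2)` for all
  `n + 2 ≤ L`: at even `n + 1 = 2t` from the pair `(t, t+1)`, at odd `n + 1` from the pair realising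
  the even separation `L - (n+1)` and the symmetry `T(L - n) = T(n)` — the parity obstruction of
  link reflections on even tori is absent;
* `timeTwoPtSeq_antitone` — with `T ≥ 0` (part 1) and the symmetry, the discrete lemma
  `antitone_of_mulConvex_symm` of rung D7⁺(4) gives: `T(k) ≤ T(j)` for `j ≤ k ≤ L/2`; the
  autocorrelation is NON-INCREASING in the separation up to half the torus;
* `mulConvex_le_geometric` / `timeTwoPtSeq_le_geometric` — ENDPOINT REDUCTION: a non-negative
  log-convex sequence lies below the geometric interpolation of its endpoint values, so an
  exponential bound `T(n) ≤ C θⁿ` on `0 ≤ n ≤ K` follows from the two bounds at `n = 0` and `n = K`.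

All of this holds for every compact `G`, continuous `ρ`, `β ≥ 0`; applied to the centred observable
`F - ⟨F⟩` it concerns the connected autocorrelation.  The summit-native form (the sequence
`n ↦ latticeConnectedCorr ρ β (2S+1) A A n` of `HasLatticeMassGap`) is in the sequel.

References: K. Osterwalder, E. Seiler, Ann. Phys. 110 (1978) 440, §2; E. Seiler, LNP 159 (1982)
Ch. 2; J. Glimm, A. Jaffe, *Quantum Physics* (1987) §6.1 (OS positivity, Schwarz inequality);
M. Lüscher, CMP 54 (1977) 283 (transfer matrix of lattice gauge theory). [folklore consequences
of OS positivity; the typed odd-torus statements and the endpoint reduction are this unit's]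
-/

open MeasureTheory
open Literature.MathematicalPhysics.QuantumFieldTheory

noncomputable section

namespace Summit.QuantumFields.YangMills.Theorems.SoloBlind

/-! ### Discrete lemmas: multiplicatively midpoint-convex non-negative sequences -/

section Discrete

/-- Under `a(k+1)² ≤ a(k) a(k+2)` and non-negativity an up-step `a l ≤ a (l+1)` propagates to the
right. [folklore] -/
theorem mulConvex_upStep_propagates {a : ℕ → ℝ} {K : ℕ} (h0 : ∀ k, k ≤ K → 0 ≤ a k)
    (hconv : ∀ k, k + 2 ≤ K → a (k + 1) ^ 2 ≤ a k * a (k + 2)) {l : ℕ}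
    (hup : a l ≤ a (l + 1)) : ∀ q, l ≤ q → q + 1 ≤ K → a q ≤ a (q + 1) := by
  intro q hlq hqK
  induction q with
  | zero =>
    have hl0 : l = 0 := by omega
    subst hl0
    exact hup
  | succ q ih =>
    rcases Nat.eq_or_lt_of_le hlq with h | h
    · rw [← h]; exact hup
    · have hq : a q ≤ a (q + 1) := ih (by omega) (by omega)
      have hc := hconv q (by omega)
      have h1 := h0 (q + 1) (by omega)
      have h2 := h0 (q + 2) (by omega)
      nlinarith [hc, mul_nonneg (sub_nonneg.mpr hq) h2, h1, h2]

/-- A non-negative multiplicatively midpoint-convex sequence attains its maximum over `[0, K]` at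
an endpoint. [folklore] -/
theorem mulConvex_le_max {a : ℕ → ℝ} {K : ℕ} (h0 : ∀ k, k ≤ K → 0 ≤ a k)
    (hconv : ∀ k, k + 2 ≤ K → a (k + 1) ^ 2 ≤ a k * a (k + 2)) {n : ℕ} (hn : n ≤ K) :
    a n ≤ max (a 0) (a K) := by
  by_contra hlt
  push Not at hlt
  have hn0 : a 0 < a n := lt_of_le_of_lt (le_max_left _ _) hlt
  have hnK : a K < a n := lt_of_le_of_lt (le_max_right _ _) hlt
  by_cases hdown : ∀ l, l + 1 ≤ n → a (l + 1) ≤ a l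
  · -- no up-step before `n`: then `a n ≤ a 0`
    have hle : ∀ q, q ≤ n → a q ≤ a 0 := by
      intro q hq
      induction q with
      | zero => exact le_rfl
      | succ q ih => exact (hdown q (by omega)).trans (ih (by omega))
    exact absurd (hle n le_rfl) (not_le.mpr hn0)
  · -- an up-step before `n` propagates up to `K`: then `a n ≤ a K`
    push Not at hdown
    obtain ⟨l, hl, hup⟩ := hdown
    have hmono := mulConvex_upStep_propagates h0 hconv hup.le
    have hle : ∀ q, n ≤ q → q ≤ K → a n ≤ a q := by
      intro q hnq hqK
      induction q with
      | zero =>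
        have hn' : n = 0 := by omega
        rw [hn']
      | succ q ih =>
        rcases Nat.eq_or_lt_of_le hnq with h | h
        · rw [h]
        · exact (ih (by omega) (by omega)).trans (hmono q (by omega) (by omega))
    exact absurd (hle K hn le_rfl) (not_le.mpr hnK)

/-- **Endpoint reduction.**  A non-negative multiplicatively midpoint-convex sequence lies below
the geometric interpolation of bounds at its endpoints: `a 0 ≤ C`, `a K ≤ C θ^K` (`θ > 0`) imply
`a n ≤ C θ^n` for all `n ≤ K`. [folklore] -/
theorem mulConvex_le_geometric {a : ℕ → ℝ} {K : ℕ} (h0 : ∀ k, k ≤ K → 0 ≤ a k)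
    (hconv : ∀ k, k + 2 ≤ K → a (k + 1) ^ 2 ≤ a k * a (k + 2)) {C θ : ℝ} (hθ : 0 < θ)
    (hC0 : a 0 ≤ C) (hCK : a K ≤ C * θ ^ K) {n : ℕ} (hn : n ≤ K) : a n ≤ C * θ ^ n := by
  set b : ℕ → ℝ := fun k => a k / θ ^ k with hb
  have hb0 : ∀ k, k ≤ K → 0 ≤ b k := fun k hk => div_nonneg (h0 k hk) (pow_nonneg hθ.le k)
  have hbconv : ∀ k, k + 2 ≤ K → b (k + 1) ^ 2 ≤ b k * b (k + 2) := by
    intro k hk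
    have hc := hconv k hk
    have hpow : (θ ^ (k + 1)) ^ 2 = θ ^ k * θ ^ (k + 2) := by ring
    simp only [hb, div_pow, div_mul_div_comm, hpow]
    exact div_le_div_of_nonneg_right hc (by positivity)
  have key := mulConvex_le_max hb0 hbconv hn
  have hbK : b K ≤ C := by
    simp only [hb]
    rw [div_le_iff₀ (pow_pos hθ K)]
    exact hCK
  have hb00 : b 0 ≤ C := by
    simp only [hb, pow_zero, div_one]
    exact hC0
  have hbn : b n ≤ C := key.trans (max_le hb00 hbK)
  simp only [hb] at hbn
  rwa [div_le_iff₀ (pow_pos hθ n)] at hbn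

end Discrete

/-! ### The time autocorrelation of a time-zero spatial observable on the odd torus -/

section TwoPoint

variable {d L N : ℕ} [NeZero d] [NeZero L] {G : Type*} [Group G] [TopologicalSpace G]
  [IsTopologicalGroup G] [CompactSpace G] [MeasurableSpace G] [BorelSpace G]
  (ρ : G →* Matrix (Fin N) (Fin N) ℂ)

/-- The time autocorrelation `T_F(s) = ⟨F · F(· + s e₀)⟩_{Λ,β}` of a real observable on the
torus `(ℤ/L)^d`. -/
def timeTwoPt (β : ℝ) (F : GaugeConfig d L G → ℝ) (s : ZMod L) : ℝ :=
  wilsonExpectation ρ β fun U =>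
    F U * F (torusConfigShift (-(Pi.single (0 : Fin d) s : Site d L)) U)

/-- The sequence `n ↦ T_F(n mod L)`. -/
def timeTwoPtSeq (β : ℝ) (F : GaugeConfig d L G → ℝ) (n : ℕ) : ℝ :=
  timeTwoPt ρ β F (n : ZMod L)

/-- Translation invariance: `⟨F(· + a e₀) F(· + b e₀)⟩ = T_F(b - a)`. [folklore] -/
theorem wilsonExpectation_translate_mul_translate (β : ℝ) (F : GaugeConfig d L G → ℝ)
    (a b : ZMod L) :
    wilsonExpectation ρ β (fun U =>
        F (torusConfigShift (-(Pi.single (0 : Fin d) a : Site d L)) U) *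
          F (torusConfigShift (-(Pi.single (0 : Fin d) b : Site d L)) U)) =
      timeTwoPt ρ β F (b - a) := by
  unfold timeTwoPt
  rw [← wilsonExpectation_comp_torusConfigShift ρ β (-(Pi.single (0 : Fin d) a : Site d L))
    (fun U => F U * F (torusConfigShift (-(Pi.single (0 : Fin d) (b - a) : Site d L)) U))]
  have hv : -(Pi.single (0 : Fin d) (b - a) : Site d L) + -(Pi.single (0 : Fin d) a : Site d L) =
      -(Pi.single (0 : Fin d) b : Site d L) := by
    rw [← neg_add, ← Pi.single_add, sub_add_cancel]
  have hcomp : ∀ V : GaugeConfig d L G,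
      torusConfigShift (-(Pi.single (0 : Fin d) (b - a) : Site d L))
          (torusConfigShift (-(Pi.single (0 : Fin d) a : Site d L)) V) =
        torusConfigShift (-(Pi.single (0 : Fin d) b : Site d L)) V := fun V => by
    funext e
    simp only [torusConfigShift_apply, sub_sub, hv]
  congr 1
  funext U
  simp only [Function.comp_apply, hcomp]

/-- The autocorrelation is even: `T_F(-s) = T_F(s)`. [folklore] -/
theorem timeTwoPt_neg (β : ℝ) (F : GaugeConfig d L G → ℝ) (s : ZMod L) :
    timeTwoPt ρ β F (-s) = timeTwoPt ρ β F s :=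
  (wilsonExpectation_twoPoint_neg ρ β F s).symm

/-- Symmetry of the sequence: `T(L - n) = T(n)` for `n ≤ L`. [folklore] -/
theorem timeTwoPtSeq_symm (β : ℝ) (F : GaugeConfig d L G → ℝ) {n : ℕ} (hn : n ≤ L) :
    timeTwoPtSeq ρ β F (L - n) = timeTwoPtSeq ρ β F n := by
  unfold timeTwoPtSeq
  rw [Nat.cast_sub hn, ZMod.natCast_self, zero_sub, timeTwoPt_neg]

/-- Non-negativity (part 1): `0 ≤ ⟨F⟩² ≤ T_F(s)` for a time-zero spatial `F`, `L ≥ 3` odd,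
`β ≥ 0`. [folklore] -/
theorem timeTwoPt_nonneg (hL : Odd L) (hL3 : 3 ≤ L) (hρ : Continuous ρ) {β : ℝ} (hβ : 0 ≤ β)
    {F : GaugeConfig d L G → ℝ} (hFm : Measurable F) (hFb : ∃ C : ℝ, ∀ U, |F U| ≤ C)
    (hF0 : DependsOn F {e : Edge d L | e.1 0 = 0 ∧ e.2 ≠ 0}) (s : ZMod L) :
    0 ≤ timeTwoPt ρ β F s :=
  (sq_nonneg _).trans (wilsonExpectation_sq_le_timeZero_twoPoint ρ hL hL3 hρ hβ hFm hFb hF0 s)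

/-- **Schwarz inequality of the OS form for two translates** of a time-zero spatial observable:
`T(t + t' - 1)² ≤ T(2t - 1) · T(2t' - 1)` for slices `1 ≤ t, t' ≤ L/2 + 1` (`L ≥ 3` odd,
`β ≥ 0`).  [folklore: the Gram matrix `⟨ΘF_t · F_{t'}⟩ = T(t + t' - 1)` is positive
semi-definite] -/
theorem timeTwoPt_schwarz (hL : Odd L) (hL3 : 3 ≤ L) (hρ : Continuous ρ) {β : ℝ} (hβ : 0 ≤ β)
    {F : GaugeConfig d L G → ℝ} (hFm : Measurable F) (hFb : ∃ C : ℝ, ∀ U, |F U| ≤ C)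
    (hF0 : DependsOn F {e : Edge d L | e.1 0 = 0 ∧ e.2 ≠ 0}) {t t' : ZMod L}
    (ht1 : 1 ≤ t.val) (ht2 : t.val ≤ L / 2 + 1) (ht'1 : 1 ≤ t'.val) (ht'2 : t'.val ≤ L / 2 + 1) :
    (timeTwoPt ρ β F (t + t' - 1)) ^ 2 ≤
      timeTwoPt ρ β F (2 * t - 1) * timeTwoPt ρ β F (2 * t' - 1) := by
  haveI := isProbabilityMeasure_wilsonMeasure (d := d) (L := L) (G := G) ρ hρ β
  obtain ⟨C, hC⟩ := hFb
  have hC0 : 0 ≤ C := le_trans (abs_nonneg _) (hC (fun _ => 1))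
  -- shorthand for the translates
  have hτm : ∀ s : ZMod L, Measurable fun U : GaugeConfig d L G =>
      F (torusConfigShift (-(Pi.single (0 : Fin d) s : Site d L)) U) :=
    fun s => hFm.comp (torusConfigShift _).measurable
  have hI : ∀ a b : ZMod L, Integrable (fun U : GaugeConfig d L G =>
      F (torusConfigShift (-(Pi.single (0 : Fin d) a : Site d L)) U) *
        F (torusConfigShift (-(Pi.single (0 : Fin d) b : Site d L)) U)) (wilsonMeasure ρ β) := by
    intro a b
    refine Integrable.of_bound ((hτm a).mul (hτm b)).aestronglyMeasurable (C * C)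
      (ae_of_all _ fun U => ?_)
    rw [Real.norm_eq_abs, abs_mul]
    exact mul_le_mul (hC _) (hC _) (abs_nonneg _) hC0
  -- the quadratic form `λ ↦ ⟨Θ(F_t + λ F_{t'}) · (F_t + λ F_{t'})⟩ ≥ 0`
  have hquad : ∀ lam : ℝ, 0 ≤ timeTwoPt ρ β F (2 * t' - 1) * (lam * lam) +
      (2 * timeTwoPt ρ β F (t + t' - 1)) * lam + timeTwoPt ρ β F (2 * t - 1) := by
    intro lam
    set P : GaugeConfig d L G → ℝ := fun U =>
      F (torusConfigShift (-(Pi.single (0 : Fin d) t : Site d L)) U) +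
        lam * F (torusConfigShift (-(Pi.single (0 : Fin d) t' : Site d L)) U) with hP
    have hPm : Measurable P := (hτm t).add ((hτm t').const_mul lam)
    have hPb : ∃ C' : ℝ, ∀ U, |P U| ≤ C' := by
      refine ⟨C + |lam| * C, fun U => ?_⟩
      rw [hP]
      calc |F (torusConfigShift (-(Pi.single (0 : Fin d) t : Site d L)) U) +
              lam * F (torusConfigShift (-(Pi.single (0 : Fin d) t' : Site d L)) U)|
          ≤ |F (torusConfigShift (-(Pi.single (0 : Fin d) t : Site d L)) U)| +
              |lam * F (torusConfigShift (-(Pi.single (0 : Fin d) t' : Site d L)) U)| :=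
            abs_add_le _ _
        _ = |F (torusConfigShift (-(Pi.single (0 : Fin d) t : Site d L)) U)| +
              |lam| * |F (torusConfigShift (-(Pi.single (0 : Fin d) t' : Site d L)) U)| := by
            rw [abs_mul]
        _ ≤ C + |lam| * C := by gcongr; exacts [hC _, hC _]
    have hPdep : DependsOn P
        ((WilsonOddRP.oPosEdges ∪ WilsonOddRP.oSharedEdges : Finset (Edge d L)) :
          Set (Edge d L)) := fun U V hUV => by
      simp only [hP, dependsOn_timeZero_translate hF0 ht1 ht2 hUV,
        dependsOn_timeZero_translate hF0 ht'1 ht'2 hUV]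
    have hRP := wilsonExpectation_odd_centred_timeReflect_mul_nonneg ρ hL hL3 hρ hβ hPm hPb
      hPdep 0
    simp only [sub_zero] at hRP
    -- expand the integrand, using `ΘF_t = F_{1-t}`
    have hexp : (fun U => P U.timeReflect * P U) = fun U =>
        F (torusConfigShift (-(Pi.single (0 : Fin d) (1 - t) : Site d L)) U) *
            F (torusConfigShift (-(Pi.single (0 : Fin d) t : Site d L)) U) +
          lam * (F (torusConfigShift (-(Pi.single (0 : Fin d) (1 - t) : Site d L)) U) *
            F (torusConfigShift (-(Pi.single (0 : Fin d) t' : Site d L)) U)) +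
          lam * (F (torusConfigShift (-(Pi.single (0 : Fin d) (1 - t') : Site d L)) U) *
            F (torusConfigShift (-(Pi.single (0 : Fin d) t : Site d L)) U)) +
          lam * lam * (F (torusConfigShift (-(Pi.single (0 : Fin d) (1 - t') : Site d L)) U) *
            F (torusConfigShift (-(Pi.single (0 : Fin d) t' : Site d L)) U)) := by
      funext U
      simp only [hP, timeZero_translate_timeReflect hF0 t U, timeZero_translate_timeReflect hF0 t' U]
      ring
    rw [hexp] at hRP
    have i1 := hI (1 - t) t
    have i2 : Integrable (fun U : GaugeConfig d L G => lam *
        (F (torusConfigShift (-(Pi.single (0 : Fin d) (1 - t) : Site d L)) U) *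
          F (torusConfigShift (-(Pi.single (0 : Fin d) t' : Site d L)) U)))
        (wilsonMeasure ρ β) := (hI (1 - t) t').const_mul lam
    have i3 : Integrable (fun U : GaugeConfig d L G => lam *
        (F (torusConfigShift (-(Pi.single (0 : Fin d) (1 - t') : Site d L)) U) *
          F (torusConfigShift (-(Pi.single (0 : Fin d) t : Site d L)) U)))
        (wilsonMeasure ρ β) := (hI (1 - t') t).const_mul lam
    have i4 : Integrable (fun U : GaugeConfig d L G => lam * lam *
        (F (torusConfigShift (-(Pi.single (0 : Fin d) (1 - t') : Site d L)) U) *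
          F (torusConfigShift (-(Pi.single (0 : Fin d) t' : Site d L)) U)))
        (wilsonMeasure ρ β) := (hI (1 - t') t').const_mul (lam * lam)
    have i12 : Integrable (fun U : GaugeConfig d L G =>
        F (torusConfigShift (-(Pi.single (0 : Fin d) (1 - t) : Site d L)) U) *
            F (torusConfigShift (-(Pi.single (0 : Fin d) t : Site d L)) U) +
          lam * (F (torusConfigShift (-(Pi.single (0 : Fin d) (1 - t) : Site d L)) U) *
            F (torusConfigShift (-(Pi.single (0 : Fin d) t' : Site d L)) U)))
        (wilsonMeasure ρ β) := i1.add i2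
    have i123 : Integrable (fun U : GaugeConfig d L G =>
        F (torusConfigShift (-(Pi.single (0 : Fin d) (1 - t) : Site d L)) U) *
            F (torusConfigShift (-(Pi.single (0 : Fin d) t : Site d L)) U) +
          lam * (F (torusConfigShift (-(Pi.single (0 : Fin d) (1 - t) : Site d L)) U) *
            F (torusConfigShift (-(Pi.single (0 : Fin d) t' : Site d L)) U)) +
          lam * (F (torusConfigShift (-(Pi.single (0 : Fin d) (1 - t') : Site d L)) U) *
            F (torusConfigShift (-(Pi.single (0 : Fin d) t : Site d L)) U)))
        (wilsonMeasure ρ β) := i12.add i3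
    unfold wilsonExpectation at hRP
    beta_reduce at hRP
    rw [integral_add i123 i4, integral_add i12 i3, integral_add i1 i2, integral_const_mul,
      integral_const_mul, integral_const_mul] at hRP
    have e1 := wilsonExpectation_translate_mul_translate ρ β F (1 - t) t
    have e2 := wilsonExpectation_translate_mul_translate ρ β F (1 - t) t'
    have e3 := wilsonExpectation_translate_mul_translate ρ β F (1 - t') t
    have e4 := wilsonExpectation_translate_mul_translate ρ β F (1 - t') t'
    unfold wilsonExpectation at e1 e2 e3 e4
    rw [e1, e2, e3, e4] at hRP
    have s1 : t - (1 - t) = 2 * t - 1 := by ring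
    have s2 : t' - (1 - t) = t + t' - 1 := by ring
    have s3 : t - (1 - t') = t + t' - 1 := by ring
    have s4 : t' - (1 - t') = 2 * t' - 1 := by ring
    rw [s1, s2, s3, s4] at hRP
    nlinarith [hRP]
  have hd := discrim_le_zero hquad
  rw [discrim] at hd
  nlinarith [hd]

/-- **Consecutive log-convexity** of the autocorrelation sequence on the odd torus:
`T(n+1)² ≤ T(n) · T(n+2)` for `n + 2 ≤ L` (`L ≥ 3` odd, `β ≥ 0`, `F` time-zero spatial).
[folklore; on odd `L` one reflection gives all separations] -/
theorem timeTwoPtSeq_logConvex (hL : Odd L) (hL3 : 3 ≤ L) (hρ : Continuous ρ) {β : ℝ}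
    (hβ : 0 ≤ β) {F : GaugeConfig d L G → ℝ} (hFm : Measurable F)
    (hFb : ∃ C : ℝ, ∀ U, |F U| ≤ C) (hF0 : DependsOn F {e : Edge d L | e.1 0 = 0 ∧ e.2 ≠ 0})
    (n : ℕ) (hn : n + 2 ≤ L) :
    timeTwoPtSeq ρ β F (n + 1) ^ 2 ≤ timeTwoPtSeq ρ β F n * timeTwoPtSeq ρ β F (n + 2) := by
  obtain ⟨m, hm⟩ := hL
  have hdiv : L / 2 = m := by omega
  -- the Schwarz inequality for slices `i, i+1` with `1 ≤ i ≤ m`, in sequence form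
  have key : ∀ i : ℕ, 1 ≤ i → i ≤ m →
      timeTwoPtSeq ρ β F (2 * i) ^ 2 ≤
        timeTwoPtSeq ρ β F (2 * i - 1) * timeTwoPtSeq ρ β F (2 * i + 1) := by
    intro i hi1 hi2
    have hiL : i < L := by omega
    have hi1L : i + 1 < L := by omega
    have hv : ((i : ℕ) : ZMod L).val = i := by rw [ZMod.val_natCast, Nat.mod_eq_of_lt hiL]
    have hv' : ((i + 1 : ℕ) : ZMod L).val = i + 1 := by
      rw [ZMod.val_natCast, Nat.mod_eq_of_lt hi1L]
    have h := timeTwoPt_schwarz ρ ⟨m, hm⟩ hL3 hρ hβ hFm hFb hF0 (t := ((i : ℕ) : ZMod L))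
      (t' := ((i + 1 : ℕ) : ZMod L)) (by rw [hv]; exact hi1) (by rw [hv]; omega)
      (by rw [hv']; omega) (by rw [hv']; omega)
    have c1 : ((i : ℕ) : ZMod L) + ((i + 1 : ℕ) : ZMod L) - 1 = ((2 * i : ℕ) : ZMod L) := by
      push_cast; ring
    have c2 : 2 * ((i : ℕ) : ZMod L) - 1 = ((2 * i - 1 : ℕ) : ZMod L) := by
      rw [Nat.cast_sub (by omega : 1 ≤ 2 * i)]; push_cast; ring
    have c3 : 2 * ((i + 1 : ℕ) : ZMod L) - 1 = ((2 * i + 1 : ℕ) : ZMod L) := by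
      push_cast; ring
    rw [c1, c2, c3] at h
    exact h
  rcases Nat.even_or_odd (n + 1) with ⟨i, hi⟩ | ⟨i, hi⟩
  · -- `n + 1 = 2i` with `1 ≤ i ≤ m`
    have h := key i (by omega) (by omega)
    have e0 : 2 * i = n + 1 := by omega
    have e1 : 2 * i - 1 = n := by omega
    have e2 : 2 * i + 1 = n + 2 := by omega
    rw [e1, e2, e0] at h
    exact h
  · -- `n + 1 = 2i + 1`: use the even separation `L - (n+1) = 2(m - i)` and the symmetry
    have h := key (m - i) (by omega) (by omega)
    have e0 : 2 * (m - i) = L - (n + 1) := by omega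
    have e1 : 2 * (m - i) - 1 = L - (n + 2) := by omega
    have e2 : 2 * (m - i) + 1 = L - n := by omega
    rw [e1, e2, e0, timeTwoPtSeq_symm ρ β F (by omega : n + 1 ≤ L),
      timeTwoPtSeq_symm ρ β F (by omega : n + 2 ≤ L), timeTwoPtSeq_symm ρ β F (by omega : n ≤ L)]
      at h
    rw [mul_comm]
    exact h

/-- **Monotonicity**: the autocorrelation of a time-zero spatial observable on the odd torus is
NON-INCREASING in the separation up to half the torus: `T(k) ≤ T(j)` for `j ≤ k ≤ L/2`
(`L ≥ 3` odd, `β ≥ 0`). [folklore] -/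
theorem timeTwoPtSeq_antitone (hL : Odd L) (hL3 : 3 ≤ L) (hρ : Continuous ρ) {β : ℝ}
    (hβ : 0 ≤ β) {F : GaugeConfig d L G → ℝ} (hFm : Measurable F)
    (hFb : ∃ C : ℝ, ∀ U, |F U| ≤ C) (hF0 : DependsOn F {e : Edge d L | e.1 0 = 0 ∧ e.2 ≠ 0})
    {j k : ℕ} (hjk : j ≤ k) (hk : 2 * k ≤ L) :
    timeTwoPtSeq ρ β F k ≤ timeTwoPtSeq ρ β F j :=
  antitone_of_mulConvex_symm (K := L)
    (fun _ _ => timeTwoPt_nonneg ρ hL hL3 hρ hβ hFm hFb hF0 _)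
    (fun n hn => timeTwoPtSeq_logConvex ρ hL hL3 hρ hβ hFm hFb hF0 n hn)
    (fun _ hn => timeTwoPtSeq_symm ρ β F hn) hjk hk

/-- **Endpoint reduction** for the autocorrelation: if `T(0) ≤ C` and `T(K) ≤ C θ^K` for some
`K ≤ L`, `θ > 0`, then `T(n) ≤ C θ^n` for all `n ≤ K` (`L ≥ 3` odd, `β ≥ 0`, `F` time-zero
spatial). [this unit's; elementary from log-convexity] -/
theorem timeTwoPtSeq_le_geometric (hL : Odd L) (hL3 : 3 ≤ L) (hρ : Continuous ρ) {β : ℝ}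
    (hβ : 0 ≤ β) {F : GaugeConfig d L G → ℝ} (hFm : Measurable F)
    (hFb : ∃ C : ℝ, ∀ U, |F U| ≤ C) (hF0 : DependsOn F {e : Edge d L | e.1 0 = 0 ∧ e.2 ≠ 0})
    {K : ℕ} (hK : K ≤ L) {C θ : ℝ} (hθ : 0 < θ) (hC0 : timeTwoPtSeq ρ β F 0 ≤ C)
    (hCK : timeTwoPtSeq ρ β F K ≤ C * θ ^ K) {n : ℕ} (hn : n ≤ K) :
    timeTwoPtSeq ρ β F n ≤ C * θ ^ n :=
  mulConvex_le_geometric (K := K)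
    (fun _ _ => timeTwoPt_nonneg ρ hL hL3 hρ hβ hFm hFb hF0 _)
    (fun k hk => timeTwoPtSeq_logConvex ρ hL hL3 hρ hβ hFm hFb hF0 k (hk.trans hK)) hθ hC0 hCK hn

end TwoPoint

end Summit.QuantumFields.YangMills.Theorems.SoloBlind

end
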